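import Literature.NumberTheory.IwasawaTheory.EquivariantUnramifiedHomsZpTowerFinite
import Mathlib.GroupTheory.PGroup
import HarnessLib

/-!
# `Γ_K`-equivariant vanishing ⟹ `Gal(K̄/K_n)`-equivariant vanishing: the `p`-group fixed-point bridge between
# door L6 («no `V`-isotypic class up the cyclotomic tower», `Γ_K`-equivariant maps) and the ISOTYPIC bounded-multiplicity
# criteria (counts of `Gal(K̄/K_n)`-equivariant maps) (proved; no definition, no named fact, no `sorry`)

`Proofs`-style file (theorems only) in topic `NumberTheory/IwasawaTheory` (namespace
`Literature.NumberTheory.IwasawaTheory.EquivariantHomLayerOfAbsolute`), written by the prover seat `bsd-potss-rkm` g39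
(cell `bsd-potss`; item stmt-BirchSwinnertonDyer-19196 `ReducibleKatoMember`, `--supports`; closes nothing; neither
Conjecture A nor BSD is proved for any curve here).

THE LEMMA (Washington's trick in the proof of Thm. 10.4 / Nakayama: a `p`-group acting on a non-zero finite `p`-group has a
non-zero fixed point).  `Γ` a group acting on a finite abelian group `C` (through `act : Γ →* MulAut C`) and on a finite
`p`-torsion module `V`; `Λ ⊴ Γ`; `τ ∈ Γ` with `τ^{pⁿ} ∈ Λ` and `Γ = ⋃ₖ τᵏ Λ`.  If every `Γ`-equivariant additive map
`C → V` is zero, then every `Λ`-equivariant additive map `C → V` is zero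
(`natCard_equivariantHom_eq_one_of_forall_eq_zero`): the `Λ`-equivariant maps form a finite elementary abelian `p`-group `X`
on which `τ ⋆ μ = τ • μ(τ⁻¹ ·)` acts through a cyclic `p`-group with fixed points the `Γ`-equivariant maps, and
`#X ≡ #X^{⟨τ⟩} = 1 (mod p)` forces `#X = 1`.

THE INSTANCE (`natCard_equivariantHom_layerSubgroup_eq_one_of_forall_eq_zero`).  `K` a number field, `κ` a `ℤ_p`-extension
with layers `Gal(K̄/K_n) = κ⁻¹(pⁿℤ_p)`, `F ⊆ K̄` finite Galois over `K`, `V` a finite `p`-torsion `Γ_K`-module: if every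
`Γ_K`-equivariant additive `Cl(𝓞_F) → V` is zero then for every `n` the `Gal(K̄/K_n)`-equivariant additive maps `Cl(𝓞_F) → V`
number exactly `1` (`τ` = any element with `κ(τ) = 1`; `γ = τ^{appr_n κ(γ)} · λ`).  This glues the OUTPUT of the cell's door L6
(`EquivariantIwasawaLemma.equivariantHom_classGroup_eq_zero_layer_compositum_tower_of_totallyRamified`, conjA-anchor g16:
`Γ_K`-equivariant vanishing on `Cl(L₀K_n)`) to the INPUT of the isotypic bounded-multiplicity criteria
(`EquivariantUnramifiedHomsZpTowerFinite.equivariantUnramifiedHoms_finite_of_card_le`, conjA-anchor g19; the reducible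
isotypic road `FineSelmerReducibleIsotypicMuRoad`, rkm g38), which count `Gal(K̄/K_n)`-equivariant maps.

References: [Washington1997] L. C. Washington, *Introduction to Cyclotomic Fields*, 2nd ed., GTM 83 (1997), §10.1 proof of
Thm. 10.4 (the `p`-group fixed-point count), §13.3 Lemma 13.16 (Nakayama); [NeukirchANT1999] Ch. IV §1.
-/

set_option autoImplicit false

noncomputable section

open scoped Classical Pointwise NumberField
open NumberField Field IntermediateField MulAction

namespace Literature.NumberTheory.IwasawaTheory.EquivariantHomLayerOfAbsolute

open Literature.NumberTheory.GaloisRepresentations Literature.NumberTheory.NumberFields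
  Literature.NumberTheory.EllipticCurves Literature.NumberTheory.IwasawaTheory.EquivariantUnramifiedHomsZpTowerFinite

/-! ## §1 The abstract `p`-group fixed-point bridge -/

section Abstract

variable {Γ : Type*} [Group Γ] {C : Type*} [CommGroup C] [Finite C]
  {V : Type*} [AddCommGroup V] [Finite V] [DistribMulAction Γ V]

/-- **The `p`-group fixed-point bridge.**  `Γ` acts on the finite abelian group `C` (through `act`) and on the finite
`p`-torsion module `V`; `Λ ⊴ Γ`, `τ ∈ Γ` with `τ^{pⁿ} ∈ Λ` and every `γ ∈ Γ` of the form `τᵏ λ` (`λ ∈ Λ`).  If every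
`Γ`-equivariant additive `C → V` vanishes, then the `Λ`-equivariant additive maps `C → V` number exactly one (the zero map):
they form a finite elementary abelian `p`-group on which `⟨τ⟩` acts through a cyclic `p`-group (`μ ↦ τ • μ(τ⁻¹ ·)`) whose
fixed points are the `Γ`-equivariant maps, and `#X ≡ #X^{⟨τ⟩} (mod p)`.
[cite: Washington1997, §10.1 Thm. 10.4 (proof: a p-group acting on a p-group) and §13.3 Lemma 13.16] -/
theorem natCard_equivariantHom_eq_one_of_forall_eq_zero (act : Γ →* MulAut C) (Λ : Subgroup Γ) [Λ.Normal]
    {p : ℕ} [Fact p.Prime] (hpV : ∀ v : V, p • v = 0) (τ : Γ) {n : ℕ} (hτ : τ ^ (p ^ n) ∈ Λ)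
    (hgen : ∀ γ : Γ, ∃ (k : ℕ) (l : Γ), l ∈ Λ ∧ γ = τ ^ k * l)
    (h0 : ∀ μ : Additive C →+ V,
      (∀ (γ : Γ) (c : C), μ (Additive.ofMul (act γ c)) = γ • μ (Additive.ofMul c)) → μ = 0) :
    Nat.card {μ : Additive C →+ V // ∀ γ ∈ Λ, ∀ c : C, μ (Additive.ofMul (act γ c)) = γ • μ (Additive.ofMul c)} = 1 := by
  have hp : p.Prime := Fact.out
  -- the twist `τ ⋆ μ = τ • μ(τ⁻¹ ·)` of an additive map `C → V`
  let tw : Γ → (Additive C →+ V) → (Additive C →+ V) := fun γ μ =>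
    (DistribSMul.toAddMonoidHom V γ).comp (μ.comp (MonoidHom.toAdditive (act γ⁻¹).toMonoidHom))
  have tw_apply : ∀ (γ : Γ) (μ : Additive C →+ V) (c : Additive C),
      tw γ μ c = γ • μ (Additive.ofMul (act γ⁻¹ (Additive.toMul c))) := fun _ _ _ => rfl
  have tw_one : ∀ μ : Additive C →+ V, tw 1 μ = μ := fun μ => by
    refine AddMonoidHom.ext fun c => ?_
    rw [tw_apply, inv_one, map_one, MulAut.one_apply, one_smul, ofMul_toMul]
  have tw_mul : ∀ (σ τ : Γ) (μ : Additive C →+ V), tw (σ * τ) μ = tw σ (tw τ μ) := fun σ τ μ => by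
    refine AddMonoidHom.ext fun c => ?_
    rw [tw_apply, tw_apply, tw_apply, toMul_ofMul, mul_inv_rev, map_mul, MulAut.mul_apply, mul_smul]
  -- a `Λ`-equivariant map is fixed by the twists of `Λ`
  have tw_eq_self : ∀ μ : Additive C →+ V,
      (∀ γ ∈ Λ, ∀ c : C, μ (Additive.ofMul (act γ c)) = γ • μ (Additive.ofMul c)) →
      ∀ l ∈ Λ, tw l μ = μ := fun μ hμ l hl => by
    refine AddMonoidHom.ext fun c => ?_
    rw [tw_apply, hμ l⁻¹ (Λ.inv_mem hl), smul_inv_smul, ofMul_toMul]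
  -- the twist of a `Λ`-equivariant map is `Λ`-equivariant (`Λ ⊴ Γ`)
  have tw_equivariant : ∀ (τ : Γ) (μ : Additive C →+ V),
      (∀ γ ∈ Λ, ∀ c : C, μ (Additive.ofMul (act γ c)) = γ • μ (Additive.ofMul c)) →
      ∀ γ ∈ Λ, ∀ c : C, tw τ μ (Additive.ofMul (act γ c)) = γ • tw τ μ (Additive.ofMul c) := by
    intro τ μ hμ γ hγ c
    rw [tw_apply, tw_apply, toMul_ofMul, toMul_ofMul]
    have hconj : τ⁻¹ * γ * τ⁻¹⁻¹ ∈ Λ := Subgroup.Normal.conj_mem inferInstance γ hγ τ⁻¹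
    rw [inv_inv] at hconj
    have h1 : act τ⁻¹ (act γ c) = act (τ⁻¹ * γ * τ) (act τ⁻¹ c) := by
      rw [← MulAut.mul_apply, ← map_mul, ← MulAut.mul_apply, ← map_mul, mul_assoc, mul_inv_cancel, mul_one]
    rw [h1, hμ _ hconj, ← mul_smul, ← mul_smul, mul_assoc, mul_inv_cancel_left]
  -- the `Λ`-equivariant maps as an additive subgroup `S`
  let S : AddSubgroup (Additive C →+ V) :=
    { carrier := {μ | ∀ γ ∈ Λ, ∀ c : C, μ (Additive.ofMul (act γ c)) = γ • μ (Additive.ofMul c)}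
      add_mem' := fun {μ ν} hμ hν γ hγ c => by
        rw [AddMonoidHom.add_apply, AddMonoidHom.add_apply, hμ γ hγ c, hν γ hγ c, smul_add]
      zero_mem' := fun γ _ c => by rw [AddMonoidHom.zero_apply, AddMonoidHom.zero_apply, smul_zero]
      neg_mem' := fun {μ} hμ γ hγ c => by
        rw [AddMonoidHom.neg_apply, AddMonoidHom.neg_apply, hμ γ hγ c, smul_neg] }
  have hmemS : ∀ μ : Additive C →+ V, μ ∈ S ↔
      ∀ γ ∈ Λ, ∀ c : C, μ (Additive.ofMul (act γ c)) = γ • μ (Additive.ofMul c) := fun μ => Iff.rfl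
  rw [show Nat.card {μ : Additive C →+ V // ∀ γ ∈ Λ, ∀ c : C, μ (Additive.ofMul (act γ c)) = γ • μ (Additive.ofMul c)} =
      Nat.card S from Nat.card_congr (Equiv.subtypeEquivRight fun μ => (hmemS μ).symm)]
  haveI : Finite (Additive C →+ V) :=
    Finite.of_injective (fun ν => (ν : Additive C → V)) fun ν ν' h => DFunLike.coe_injective h
  haveI : Finite S := inferInstance
  -- every element of `S` is killed by `p`
  have hpS : ∀ s : S, p • s = 0 := fun s => by
    refine Subtype.ext (AddMonoidHom.ext fun c => ?_)
    rw [AddSubgroup.coe_nsmul, AddMonoidHom.nsmul_apply, hpV]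
    rfl
  -- `#S` is a power of `p`
  have hcardS : ∃ m : ℕ, Nat.card S = p ^ m := by
    refine ⟨(Nat.card S).primeFactorsList.length,
      Nat.eq_prime_pow_of_unique_prime_dvd Nat.card_pos.ne' fun {q} hq hqd => ?_⟩
    haveI : Fact q.Prime := ⟨hq⟩
    haveI := Fintype.ofFinite S
    rw [Nat.card_eq_fintype_card] at hqd
    obtain ⟨s, hs⟩ := exists_prime_addOrderOf_dvd_card q hqd
    have hdvd : q ∣ p := by rw [← hs]; exact addOrderOf_dvd_of_nsmul_eq_zero (hpS s)
    exact (Nat.prime_dvd_prime_iff_eq hq hp).mp hdvd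
  -- the permutation `σ` of `S` induced by `τ`
  have hmem_twist : ∀ (γ : Γ) (μ : Additive C →+ V), μ ∈ S → tw γ μ ∈ S := fun γ μ hμ =>
    (hmemS _).mpr (tw_equivariant γ μ ((hmemS μ).mp hμ))
  let σ : Equiv.Perm S :=
    { toFun := fun s => ⟨tw τ s.1, hmem_twist τ s.1 s.2⟩
      invFun := fun s => ⟨tw τ⁻¹ s.1, hmem_twist τ⁻¹ s.1 s.2⟩
      left_inv := fun s => Subtype.ext (by
        change tw τ⁻¹ (tw τ s.1) = s.1
        rw [← tw_mul, inv_mul_cancel, tw_one])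
      right_inv := fun s => Subtype.ext (by
        change tw τ (tw τ⁻¹ s.1) = s.1
        rw [← tw_mul, mul_inv_cancel, tw_one]) }
  have hσ_apply : ∀ s : S, ((σ s : S) : Additive C →+ V) = tw τ s.1 := fun s => rfl
  have hσ_pow : ∀ (k : ℕ) (s : S), (((σ ^ k) s : S) : Additive C →+ V) = tw (τ ^ k) s.1 := by
    intro k
    induction k with
    | zero => intro s; rw [pow_zero, pow_zero, Equiv.Perm.one_apply, tw_one]
    | succ k ih => intro s; rw [pow_succ, Equiv.Perm.mul_apply, pow_succ, tw_mul, ← hσ_apply]; exact ih (σ s)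
  have hσ_order : σ ^ (p ^ n) = 1 := by
    refine Equiv.ext fun s => Subtype.ext ?_
    have h := hσ_pow (p ^ n) s
    rw [tw_eq_self s.1 ((hmemS _).mp s.2) _ hτ] at h
    rw [Equiv.Perm.one_apply]
    exact h
  -- the cyclic `p`-group `H = ⟨σ⟩` acting on `S`
  set H : Subgroup (Equiv.Perm S) := Subgroup.zpowers σ with hH
  have hHp : IsPGroup p H := by
    intro g
    refine ⟨n, Subtype.ext ?_⟩
    obtain ⟨k, hk⟩ := Subgroup.mem_zpowers_iff.mp g.2
    rw [SubmonoidClass.coe_pow, ← hk, ← zpow_natCast, ← zpow_mul, mul_comm, zpow_mul, zpow_natCast, hσ_order,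
      one_zpow, OneMemClass.coe_one]
  -- its fixed points are the `Γ`-equivariant maps, i.e. `{0}`
  have hfix : ∀ s : S, s ∈ fixedPoints H S → s = 0 := by
    intro s hs
    have hστ : tw τ s.1 = s.1 := by
      have h := hs ⟨σ, Subgroup.mem_zpowers σ⟩
      rw [Subgroup.mk_smul, Equiv.Perm.smul_def] at h
      exact congrArg Subtype.val h
    have hτk : ∀ (k : ℕ) (c : C), s.1 (Additive.ofMul (act (τ ^ k) c)) = τ ^ k • s.1 (Additive.ofMul c) := by
      intro k
      induction k with
      | zero => intro c; rw [pow_zero, map_one, MulAut.one_apply, one_smul]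
      | succ k ih =>
        intro c
        have h1 : s.1 (Additive.ofMul (act τ c)) = τ • s.1 (Additive.ofMul c) := by
          have h := DFunLike.congr_fun hστ (Additive.ofMul (act τ c))
          rw [tw_apply, toMul_ofMul, ← MulAut.mul_apply, ← map_mul, inv_mul_cancel, map_one, MulAut.one_apply] at h
          exact h.symm
        rw [pow_succ, map_mul, MulAut.mul_apply, ih, h1, mul_smul]
    refine Subtype.ext (h0 s.1 fun γ c => ?_)
    obtain ⟨k, l, hl, rfl⟩ := hgen γ
    rw [map_mul, MulAut.mul_apply, hτk k, (hmemS _).mp s.2 l hl c, mul_smul]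
  have hcard_fix : Nat.card (fixedPoints H S) = 1 := by
    rw [Nat.card_eq_one_iff_unique]
    refine ⟨⟨fun a b => Subtype.ext ((hfix a.1 a.2).trans (hfix b.1 b.2).symm)⟩, ⟨⟨0, fun g => ?_⟩⟩⟩
    -- `H ≤ Stab(0)` since `σ 0 = 0`
    have hσ0 : σ (0 : S) = 0 := Subtype.ext (by
      rw [hσ_apply]
      refine AddMonoidHom.ext fun c => ?_
      rw [tw_apply]
      change τ • (0 : Additive C →+ V) _ = (0 : Additive C →+ V) c
      rw [AddMonoidHom.zero_apply, AddMonoidHom.zero_apply, smul_zero])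
    have hle : H ≤ MulAction.stabilizer (Equiv.Perm S) (0 : S) := by
      rw [hH, Subgroup.zpowers_le, MulAction.mem_stabilizer_iff, Equiv.Perm.smul_def]
      exact hσ0
    have hg := MulAction.mem_stabilizer_iff.mp (hle g.2)
    rw [Subgroup.mk_smul]
    exact hg
  -- count
  have hmod := hHp.card_modEq_card_fixedPoints S
  rw [hcard_fix] at hmod
  obtain ⟨m, hm⟩ := hcardS
  rw [hm] at hmod ⊢
  cases m with
  | zero => rw [pow_zero]
  | succ m =>
    exfalso
    have h1 : p ^ (m + 1) ≡ 0 [MOD p] := Nat.modEq_zero_iff_dvd.mpr (dvd_pow_self p (Nat.succ_ne_zero m))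
    have h2 := (h1.symm.trans hmod)
    exact hp.one_lt.ne' (Nat.eq_one_of_dvd_one (Nat.modEq_zero_iff_dvd.mp h2.symm)) |>.elim

/-- **Vanishing form** of the bridge: under the same hypotheses every `Λ`-equivariant additive map `C → V` is zero.
[cite: Washington1997, §10.1 Thm. 10.4 (proof: a p-group acting on a p-group) and §13.3 Lemma 13.16] -/
theorem equivariantHom_eq_zero_of_forall_eq_zero (act : Γ →* MulAut C) (Λ : Subgroup Γ) [Λ.Normal]
    {p : ℕ} [Fact p.Prime] (hpV : ∀ v : V, p • v = 0) (τ : Γ) {n : ℕ} (hτ : τ ^ (p ^ n) ∈ Λ)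
    (hgen : ∀ γ : Γ, ∃ (k : ℕ) (l : Γ), l ∈ Λ ∧ γ = τ ^ k * l)
    (h0 : ∀ μ : Additive C →+ V,
      (∀ (γ : Γ) (c : C), μ (Additive.ofMul (act γ c)) = γ • μ (Additive.ofMul c)) → μ = 0)
    (μ : Additive C →+ V) (hμ : ∀ γ ∈ Λ, ∀ c : C, μ (Additive.ofMul (act γ c)) = γ • μ (Additive.ofMul c)) :
    μ = 0 := by
  have h1 := natCard_equivariantHom_eq_one_of_forall_eq_zero act Λ hpV τ hτ hgen h0
  haveI : Finite (Additive C →+ V) :=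
    Finite.of_injective (fun ν => (ν : Additive C → V)) fun ν ν' h => DFunLike.coe_injective h
  have hsub := (Nat.card_eq_one_iff_unique.mp h1).1
  have h0mem : ∀ γ ∈ Λ, ∀ c : C, (0 : Additive C →+ V) (Additive.ofMul (act γ c)) = γ • (0 : Additive C →+ V)
      (Additive.ofMul c) := fun γ _ c => by rw [AddMonoidHom.zero_apply, AddMonoidHom.zero_apply, smul_zero]
  exact congrArg Subtype.val (hsub.elim ⟨μ, hμ⟩ ⟨0, h0mem⟩)

end Abstract

/-! ## §2 The instance: `Γ_K`-equivariant vanishing on `Cl(𝓞_F)` ⟹ `Gal(K̄/K_n)`-equivariant vanishing -/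

section Layer

variable {K : Type} [Field K] {p : ℕ} [Fact p.Prime]

/-- Every `γ ∈ Γ_K` is `τᵏ λ` with `λ ∈ Gal(K̄/K_n)` when `κ(τ) = 1` (`k = appr_n κ(γ)`), and `τ^{pⁿ} ∈ Gal(K̄/K_n)`.
[cite: Washington1997, §13.1 (Γ/Γ^{pⁿ} ≅ ℤ/pⁿ)] -/
theorem exists_pow_mul_mem_layerSubgroup (κ : ZpExtension K p) (τ : absoluteGaloisGroup K)
    (hτ : κ τ = Multiplicative.ofAdd 1) (n : ℕ) :
    τ ^ (p ^ n) ∈ κ.layerSubgroup n ∧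
      ∀ γ : absoluteGaloisGroup K, ∃ (k : ℕ) (l : absoluteGaloisGroup K), l ∈ κ.layerSubgroup n ∧ γ = τ ^ k * l := by
  have hτk : ∀ k : ℕ, (κ (τ ^ k)).toAdd = (k : ℤ_[p]) := fun k => by
    rw [map_pow, hτ, ← ofAdd_nsmul, toAdd_ofAdd, nsmul_eq_mul, mul_one]
  refine ⟨?_, fun γ => ?_⟩
  · rw [ZpExtension.mem_layerSubgroup, hτk, Nat.cast_pow]
  · set x : ℤ_[p] := (κ γ).toAdd with hx
    refine ⟨x.appr n, (τ ^ x.appr n)⁻¹ * γ, ?_, by rw [mul_inv_cancel_left]⟩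
    rw [ZpExtension.mem_layerSubgroup, map_mul, map_inv, toAdd_mul, toAdd_inv, hτk, ← Ideal.mem_span_singleton,
      neg_add_eq_sub]
    exact PadicInt.appr_spec n x

/-- **`Γ_K`-equivariant vanishing ⟹ `Gal(K̄/K_n)`-equivariant vanishing (counting form).**  `K` a number field, `κ` a
`ℤ_p`-extension, `F ⊆ K̄` finite Galois over `K`, `V` a finite `Γ_K`-module with `p·V = 0`.  If every additive
`Γ_K`-equivariant `Cl(𝓞_F) → V` is zero (the output shape of door L6), then for every `n` the additive maps `Cl(𝓞_F) → V`
equivariant under `Gal(K̄/K_n) = κ⁻¹(pⁿℤ_p)` (the input shape of the isotypic bounded-multiplicity criteria) number exactly `1`.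
[cite: Washington1997, §10.1 Thm. 10.4 (proof) and §13.3 Lemma 13.16] -/
theorem natCard_equivariantHom_layerSubgroup_eq_one_of_forall_eq_zero (κ : ZpExtension K p)
    (F : IntermediateField K (AlgebraicClosure K)) [IsGalois K F] [NumberField F]
    {V : Type*} [AddCommGroup V] [Finite V] [DistribMulAction (absoluteGaloisGroup K) V]
    (hpV : ∀ v : V, p • v = 0)
    (h0 : ∀ μ : Additive (ClassGroup (𝓞 F)) →+ V,
      (∀ (τ : absoluteGaloisGroup K) (c : ClassGroup (𝓞 F)),
        μ (Additive.ofMul (ClassGroup.mulEquiv (AmbiguousClass.intAut (absRestrictNormalHom F τ)) c)) =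
          τ • μ (Additive.ofMul c)) → μ = 0)
    (n : ℕ) :
    Nat.card {μ : Additive (ClassGroup (𝓞 F)) →+ V //
      ∀ γ ∈ κ.layerSubgroup n, ∀ c : ClassGroup (𝓞 F),
        μ (Additive.ofMul (ClassGroup.mulEquiv (AmbiguousClass.intAut (absRestrictNormalHom F γ)) c)) =
          γ • μ (Additive.ofMul c)} = 1 := by
  obtain ⟨τ, hτ⟩ := κ.surjective (Multiplicative.ofAdd 1)
  obtain ⟨hτn, hgen⟩ := exists_pow_mul_mem_layerSubgroup κ τ hτ n
  -- the action of `Γ_K` on `Cl(𝓞_F)` through `Gal(F/K)` as a homomorphism to `MulAut`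
  let act : absoluteGaloisGroup K →* MulAut (ClassGroup (𝓞 F)) :=
    MonoidHom.mk' (fun γ => ClassGroup.mulEquiv (AmbiguousClass.intAut (absRestrictNormalHom F γ)))
      fun σ τ => by rw [map_mul, AmbiguousClass.mulEquiv_intAut_mul]; rfl
  exact natCard_equivariantHom_eq_one_of_forall_eq_zero act (κ.layerSubgroup n) hpV τ hτn hgen h0

/-- **Vanishing form.**  Same hypotheses: every `Gal(K̄/K_n)`-equivariant additive `Cl(𝓞_F) → V` is zero.
[cite: Washington1997, §10.1 Thm. 10.4 (proof) and §13.3 Lemma 13.16] -/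
theorem equivariantHom_layerSubgroup_eq_zero_of_forall_eq_zero (κ : ZpExtension K p)
    (F : IntermediateField K (AlgebraicClosure K)) [IsGalois K F] [NumberField F]
    {V : Type*} [AddCommGroup V] [Finite V] [DistribMulAction (absoluteGaloisGroup K) V]
    (hpV : ∀ v : V, p • v = 0)
    (h0 : ∀ μ : Additive (ClassGroup (𝓞 F)) →+ V,
      (∀ (τ : absoluteGaloisGroup K) (c : ClassGroup (𝓞 F)),
        μ (Additive.ofMul (ClassGroup.mulEquiv (AmbiguousClass.intAut (absRestrictNormalHom F τ)) c)) =
          τ • μ (Additive.ofMul c)) → μ = 0)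
    (n : ℕ) (μ : Additive (ClassGroup (𝓞 F)) →+ V)
    (hμ : ∀ γ ∈ κ.layerSubgroup n, ∀ c : ClassGroup (𝓞 F),
      μ (Additive.ofMul (ClassGroup.mulEquiv (AmbiguousClass.intAut (absRestrictNormalHom F γ)) c)) =
        γ • μ (Additive.ofMul c)) :
    μ = 0 := by
  obtain ⟨τ, hτ⟩ := κ.surjective (Multiplicative.ofAdd 1)
  obtain ⟨hτn, hgen⟩ := exists_pow_mul_mem_layerSubgroup κ τ hτ n
  let act : absoluteGaloisGroup K →* MulAut (ClassGroup (𝓞 F)) :=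
    MonoidHom.mk' (fun γ => ClassGroup.mulEquiv (AmbiguousClass.intAut (absRestrictNormalHom F γ)))
      fun σ τ => by rw [map_mul, AmbiguousClass.mulEquiv_intAut_mul]; rfl
  exact equivariantHom_eq_zero_of_forall_eq_zero act (κ.layerSubgroup n) hpV τ hτn hgen h0 μ hμ

/-- **Counting form at the compositum layers `F_n = K̄^{N ∩ κ⁻¹(pⁿℤ_p)}`** (the exact input of
`EquivariantUnramifiedHomsZpTowerFinite.equivariantUnramifiedHoms_finite_of_card_le`): if at every `n` every `Γ_K`-equivariant
additive `Cl(𝓞_{F_n}) → V` is zero, the `Gal(K̄/K_n)`-equivariant ones number `≤ 1`.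
[cite: Washington1997, §10.1 Thm. 10.4 (proof) and §13.3 Lemma 13.16] -/
theorem natCard_equivariantHom_fixedField_inf_layerSubgroup_le_one [NumberField K] (κ : ZpExtension K p)
    (N : Subgroup (absoluteGaloisGroup K)) [N.Normal] (hN : IsOpen (N : Set (absoluteGaloisGroup K)))
    {V : Type*} [AddCommGroup V] [Finite V] [DistribMulAction (absoluteGaloisGroup K) V]
    (hpV : ∀ v : V, p • v = 0) (n : ℕ)
    (h0 : haveI : IsGalois K (fixedField (N ⊓ κ.layerSubgroup n) : IntermediateField K (AlgebraicClosure K)) :=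
        isGalois_fixedField_inf_layerSubgroup κ N hN n
      ∀ μ : Additive (ClassGroup (𝓞 (fixedField (N ⊓ κ.layerSubgroup n) :
          IntermediateField K (AlgebraicClosure K)))) →+ V,
        (∀ (τ : absoluteGaloisGroup K) c,
          μ (Additive.ofMul (ClassGroup.mulEquiv (AmbiguousClass.intAut
            (absRestrictNormalHom (fixedField (N ⊓ κ.layerSubgroup n) :
              IntermediateField K (AlgebraicClosure K)) τ)) c)) = τ • μ (Additive.ofMul c)) → μ = 0) :
    haveI : IsGalois K (fixedField (N ⊓ κ.layerSubgroup n) : IntermediateField K (AlgebraicClosure K)) :=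
      isGalois_fixedField_inf_layerSubgroup κ N hN n
    Nat.card {μ : Additive (ClassGroup (𝓞 (fixedField (N ⊓ κ.layerSubgroup n) :
        IntermediateField K (AlgebraicClosure K)))) →+ V //
      ∀ γ ∈ κ.layerSubgroup n, ∀ c,
        μ (Additive.ofMul (ClassGroup.mulEquiv (AmbiguousClass.intAut
          (absRestrictNormalHom (fixedField (N ⊓ κ.layerSubgroup n) :
            IntermediateField K (AlgebraicClosure K)) γ)) c)) = γ • μ (Additive.ofMul c)} ≤ 1 := by
  haveI hgal : IsGalois K (fixedField (N ⊓ κ.layerSubgroup n) : IntermediateField K (AlgebraicClosure K)) :=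
    isGalois_fixedField_inf_layerSubgroup κ N hN n
  haveI : FiniteDimensional K (fixedField (N ⊓ κ.layerSubgroup n) : IntermediateField K (AlgebraicClosure K)) :=
    finiteDimensional_fixedField_of_isOpen _ (hN.inter (κ.isOpen_layerSubgroup n))
  haveI : NumberField (fixedField (N ⊓ κ.layerSubgroup n) : IntermediateField K (AlgebraicClosure K)) :=
    NumberField.of_module_finite K _
  exact (natCard_equivariantHom_layerSubgroup_eq_one_of_forall_eq_zero κ _ hpV h0 n).le

end Layer

end Literature.NumberTheory.IwasawaTheory.EquivariantHomLayerOfAbsolute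

end
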